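import Literature.Analysis.FluidPDE.EulerSubsolutionCriterion
import Literature.Analysis.FunctionSpaces.TorusWeakFormBookkeeping
import HarnessLib

/-!
# Székelyhidi's localized convex-integration theorem: reduction to spatially localized regions

Topic `Analysis/FluidPDE`. Support file for the proof of the named fact
`Torus.Szekelyhidi2011_thm13` (`EulerSubsolutionCriterion.lean`; Székelyhidi, C. R. Math. 349
(2011), Thm. 1.3 = De Lellis–Székelyhidi, Arch. Ration. Mech. Anal. 195 (2010), Prop. 2,
localized to an open space–time region `U ⊆ (0,T) × T²`, every-time-slice form). The
constructive proof of that fact (`ConvexIntegration2D*.lean`) works in flat coordinates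
`ℝ × ℝ²`; to reach an arbitrary open `U ⊆ (0,T) × T²` one covers "inside the region `U`"
(Székelyhidi 2011, proof of Thm. 1.3). This file isolates the torus-side part of that covering:

* `Torus.Szekelyhidi2011_thm13_of_pieces` — **gluing finitely many spatially localized
  perturbations.** If `Q₁, …, Q_m ⊆ T²` are pairwise disjoint open sets covering `T²` up to a
  null set and the conclusion of `Szekelyhidi2011_thm13` is known for all data whose region lies
  in `(0,T) × Q_k` (each `k`), then `Szekelyhidi2011_thm13` holds: the instances for the pieces
  `U_k = U ∩ (ℝ × Q_k)` are glued as `ṽ = ∑ₖ ṽₖ`, `ũ = ∑ₖ 𝟙_{Q_k} ũₖ`. The truncation of the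
  stresses to their pieces is what makes the constitutive identity (6) survive *on every time
  slice* (the `ũₖ` vanish off `U_k` only a.e. in space–time): for every `t`, a.e. `x` lies in
  exactly one `Q_k`, where the glued fields coincide with `(ṽₖ, ũₖ)`. The weak identities add up
  by Fubini on `(0,T) × T²` (all fields bounded; the every-slice `L^∞` bound of `ṽₖ` is turned
  into a space–time one on a measurable modification, `ae_prod_norm_le_of_slices`).
* auxiliary facts on fields `φ : ℝ → T^d → F` with smooth space–time lift but *no* support
  condition in time (the test class of the linear system in `Szekelyhidi2011_thm13`): smoothness
  and joint continuity of `∂ₜφ`, joint continuity of the components of `∇φ`, uniform bounds on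
  `K × T^d` for compact `K` (`continuous_uncurry_timeDeriv_of_contDiff_stLift`,
  `exists_bound_timeDeriv_of_contDiff_stLift`, `continuous_uncurry_fderiv_apply_of_contDiff_stLift`,
  `exists_bound_fderiv_apply_of_contDiff_stLift`), and the pointwise algebra of the glued
  integrands (`sum_indicator_apply_apply`, `inner_sum_add_sum_sum_apply_mul`).

Everything here is proved; there are no definitions and no new named facts. Downstream use: with
a finite family of disjoint open squares of side `< ½` covering `T²` up to their boundaries, each
isometric to a planar square, `Szekelyhidi2011_thm13` reduces to its instances over a single
chart, i.e. to the planar statement produced by the flat-coordinate construction.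

## References

* L. Székelyhidi Jr., C. R. Math. Acad. Sci. Paris 349 (2011) 1063–1066, Thm. 1.3 and its proof
  ("one needs to perform the covering inside the region `U`") (`Szekelyhidi2011`).
* C. De Lellis, L. Székelyhidi Jr., Arch. Ration. Mech. Anal. 195 (2010) 225–260, Prop. 2,
  §4.5 Step 1 (`DeLellisSzekelyhidi2010`).
-/

open MeasureTheory Set Filter Function
open scoped InnerProductSpace ContDiff
open Literature.Analysis.FunctionSpaces.Torus

noncomputable section

namespace Literature.Analysis.FluidPDE

namespace Torus

variable {d : Type*} [Fintype d]
variable {F : Type*} [NormedAddCommGroup F] [NormedSpace ℝ F]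

/-! ### Smooth space–time fields without support conditions -/

section SmoothFields

/-- The time derivative of a field with smooth space–time lift has smooth space–time lift
(a copy of `contDiff_stLift_timeDeriv` of `FractionalNSReynoldsWeakIdentity.lean`). [folklore] -/
private theorem glue_contDiff_stLift_timeDeriv {φ : ℝ → UnitAddTorus d → F}
    (hφ : ContDiff ℝ ∞ (stLift φ)) :
    ContDiff ℝ ∞ (stLift (timeDeriv φ)) := by
  rw [stLift_timeDeriv]
  refine ContDiff.fderiv_apply (m := ∞)
    (f := fun (p : ℝ × EuclideanSpace ℝ d) (τ : ℝ) => stLift φ (τ, p.2)) ?_ contDiff_fst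
    contDiff_const (le_of_eq rfl)
  exact hφ.comp (contDiff_snd.prodMk (contDiff_snd.comp contDiff_fst))

/-- A field with smooth space–time lift is jointly continuous (a copy of
`continuous_uncurry_of_contDiff_stLift` of `OnsagerProofs.lean`). [folklore] -/
private theorem glue_continuous_uncurry {φ : ℝ → UnitAddTorus d → F}
    (hφ : ContDiff ℝ ∞ (stLift φ)) : Continuous (uncurry φ) :=
  continuous_uncurry_of_continuous_stLift hφ.continuous

/-- The time derivative of a field with smooth space–time lift is jointly continuous. [folklore] -/
theorem continuous_uncurry_timeDeriv_of_contDiff_stLift {φ : ℝ → UnitAddTorus d → F}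
    (hφ : ContDiff ℝ ∞ (stLift φ)) : Continuous (uncurry (timeDeriv φ)) :=
  glue_continuous_uncurry (glue_contDiff_stLift_timeDeriv hφ)

/-- A field with smooth space–time lift is bounded on `K × T^d`, `K` compact. [folklore] -/
theorem exists_bound_of_contDiff_stLift {φ : ℝ → UnitAddTorus d → F}
    (hφ : ContDiff ℝ ∞ (stLift φ)) {K : Set ℝ} (hK : IsCompact K) :
    ∃ C : ℝ, ∀ t ∈ K, ∀ x, ‖φ t x‖ ≤ C :=
  exists_norm_le_of_continuousOn_of_isCompact (S := univ) hφ.continuous.continuousOn hK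
    (subset_univ K)

/-- The time derivative of a field with smooth space–time lift is bounded on `K × T^d`,
`K` compact. [folklore] -/
theorem exists_bound_timeDeriv_of_contDiff_stLift {φ : ℝ → UnitAddTorus d → F}
    (hφ : ContDiff ℝ ∞ (stLift φ)) {K : Set ℝ} (hK : IsCompact K) :
    ∃ C : ℝ, ∀ t ∈ K, ∀ x, ‖timeDeriv φ t x‖ ≤ C :=
  exists_bound_of_contDiff_stLift (glue_contDiff_stLift_timeDeriv hφ) hK

/-- Components of the spatial derivatives of a field with smooth space–time lift are jointly
continuous. [folklore] -/
theorem continuous_uncurry_fderiv_apply_of_contDiff_stLift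
    {φ : ℝ → UnitAddTorus d → EuclideanSpace ℝ d} (hφ : ContDiff ℝ ∞ (stLift φ))
    (v : EuclideanSpace ℝ d) (i : d) :
    Continuous (uncurry fun t x => FunctionSpaces.Torus.fderiv (φ t) x v i) := by
  have hst : IsSmoothSpaceTimeOn univ φ := hφ.contDiffOn
  have h1 := (hst.lineDeriv uniqueDiffOn_univ v).continuousOn_stLift
  rw [univ_prod_univ, continuousOn_univ] at h1
  have h2 : Continuous (uncurry fun t x => FunctionSpaces.Torus.lineDeriv (φ t) x v) :=
    continuous_uncurry_of_continuous_stLift h1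
  have h3 : (uncurry fun t x => FunctionSpaces.Torus.fderiv (φ t) x v i) =
      (EuclideanSpace.proj i : EuclideanSpace ℝ d →L[ℝ] ℝ) ∘
        (uncurry fun t x => FunctionSpaces.Torus.lineDeriv (φ t) x v) := by
    funext p
    simp only [Function.comp_apply, uncurry]
    rw [FunctionSpaces.Torus.lineDeriv_eq_fderiv_apply
      ((hst.isSmooth_slice (mem_univ p.1)).isContDiff (by simp))]
    rfl
  rw [h3]
  exact (EuclideanSpace.proj i : EuclideanSpace ℝ d →L[ℝ] ℝ).continuous.comp h2

/-- A common bound for the components of the spatial derivatives of a field with smooth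
space–time lift on `K × T^d`, `K` compact. [folklore] -/
theorem exists_bound_fderiv_apply_of_contDiff_stLift [DecidableEq d]
    {φ : ℝ → UnitAddTorus d → EuclideanSpace ℝ d} (hφ : ContDiff ℝ ∞ (stLift φ)) {K : Set ℝ}
    (hK : IsCompact K) :
    ∃ M : ℝ, 0 ≤ M ∧ ∀ t ∈ K, ∀ x, ∀ j i : d,
      |FunctionSpaces.Torus.fderiv (φ t) x (EuclideanSpace.single j 1) i| ≤ M := by
  have hst : IsSmoothSpaceTimeOn univ φ := hφ.contDiffOn
  choose C hC using fun j =>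
    (hst.partialDeriv uniqueDiffOn_univ j).exists_norm_le_of_isCompact hK (subset_univ K)
  refine ⟨∑ j, |C j|, Finset.sum_nonneg fun j _ => abs_nonneg _, fun t ht x j i => ?_⟩
  have hC1 : IsContDiff 1 (φ t) := (hst.isSmooth_slice (mem_univ t)).isContDiff (by simp)
  calc |FunctionSpaces.Torus.fderiv (φ t) x (EuclideanSpace.single j 1) i|
      ≤ ‖FunctionSpaces.Torus.partialDeriv j (φ t) x‖ := by
        rw [← FunctionSpaces.Torus.partialDeriv_eq_fderiv_apply hC1, ← Real.norm_eq_abs]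
        exact PiLp.norm_apply_le _ _
    _ ≤ |C j| := (hC j t ht x).trans (le_abs_self _)
    _ ≤ ∑ j, |C j| := Finset.single_le_sum (fun j _ => abs_nonneg (C j)) (Finset.mem_univ j)

end SmoothFields

/-! ### Measure-theoretic bookkeeping on `(0,T) × T^d` -/

section Bookkeeping

/-- The product measure on `(0, T) × T^d` is the restriction of the space–time volume. [folklore] -/
private theorem restrict_prod_volume_eq_restrict (T : ℝ) :
    (volume.restrict (Ioo (0 : ℝ) T)).prod (volume : Measure (UnitAddTorus d)) =
      (volume : Measure (ℝ × UnitAddTorus d)).restrict (Ioo (0 : ℝ) T ×ˢ univ) := by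
  rw [Measure.volume_eq_prod]
  exact Measure.restrict_prod_eq_prod_univ _

/-- From every-slice bounds to a space–time bound: if `w` is jointly a.e. strongly measurable on
`ℝ × T^d` and `‖w(t, ·)‖ ≤ C` a.e. for every `t`, then `‖w‖ ≤ C` a.e. on `ℝ × T^d` (Fubini for
the super-level set of a measurable modification). [folklore] -/
private theorem ae_prod_norm_le_of_slices {G : Type*} [NormedAddCommGroup G]
    {w : ℝ → UnitAddTorus d → G} {C : ℝ}
    (hwm : AEStronglyMeasurable (uncurry w) (volume : Measure (ℝ × UnitAddTorus d)))
    (hb : ∀ t, ∀ᵐ x : UnitAddTorus d, ‖w t x‖ ≤ C) :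
    ∀ᵐ p : ℝ × UnitAddTorus d, ‖w p.1 p.2‖ ≤ C := by
  set g : ℝ × UnitAddTorus d → G := hwm.mk (uncurry w) with hg_def
  have hg : StronglyMeasurable g := hwm.stronglyMeasurable_mk
  have hae : uncurry w =ᵐ[volume] g := hwm.ae_eq_mk
  have hae' : ∀ᵐ t : ℝ, ∀ᵐ x : UnitAddTorus d, uncurry w (t, x) = g (t, x) := by
    rw [Measure.volume_eq_prod] at hae
    exact Measure.ae_ae_of_ae_prod hae
  have hN : MeasurableSet {p : ℝ × UnitAddTorus d | C < ‖g p‖} :=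
    measurableSet_lt measurable_const hg.norm.measurable
  have hnull : volume {p : ℝ × UnitAddTorus d | C < ‖g p‖} = 0 := by
    rw [Measure.volume_eq_prod, Measure.prod_apply hN]
    have h0 : ∀ᵐ t : ℝ, (volume : Measure (UnitAddTorus d))
        (Prod.mk t ⁻¹' {p : ℝ × UnitAddTorus d | C < ‖g p‖}) = 0 := by
      filter_upwards [hae'] with t ht
      refine measure_eq_zero_iff_ae_notMem.2 ?_
      filter_upwards [ht, hb t] with x hx hxb
      simp only [mem_preimage, mem_setOf_eq, not_lt]
      rw [← hx]
      exact hxb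
    rw [lintegral_congr_ae h0, lintegral_zero]
  have h1 : ∀ᵐ p : ℝ × UnitAddTorus d, ‖g p‖ ≤ C := by
    rw [ae_iff]
    simpa [not_le] using hnull
  filter_upwards [h1, hae] with p hp hpe
  have : ‖w p.1 p.2‖ = ‖uncurry w p‖ := rfl
  rw [this, hpe]
  exact hp

/-- Pairings of `L²` fields are integrable. [folklore] -/
private theorem integrable_inner_L2 {α : Type*} [MeasurableSpace α] {μ : Measure α}
    {G : Type*} [NormedAddCommGroup G] [InnerProductSpace ℝ G] {f g : α → G}
    (hf : MemLp f 2 μ) (hg : MemLp g 2 μ) : Integrable (fun x => ⟪f x, g x⟫_ℝ) μ := by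
  have hprod : Integrable (fun x => ‖f x‖ * ‖g x‖) μ := hf.norm.integrable_mul hg.norm
  exact hprod.mono' (hf.1.inner hg.1) (ae_of_all _ fun x => norm_inner_le_norm (f x) (g x))

end Bookkeeping

/-! ### Pointwise algebra of the glued fields -/

section Algebra

variable {ι : Type*} [Fintype ι]

omit [Fintype d] in
/-- Entries of a sum of indicator-truncated matrix fields. [folklore] -/
theorem sum_indicator_apply_apply (Q : ι → Set (UnitAddTorus d))
    (z : ι → ℝ → UnitAddTorus d → Matrix d d ℝ) (t : ℝ) (x : UnitAddTorus d) (i j : d) :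
    (∑ k, (Q k).indicator (z k t) x) i j =
      ∑ k, (univ ×ˢ Q k).indicator (fun p : ℝ × UnitAddTorus d => z k p.1 p.2 i j) (t, x) := by
  rw [Matrix.sum_apply]
  refine Finset.sum_congr rfl fun k _ => ?_
  by_cases hx : x ∈ Q k
  · rw [indicator_of_mem hx, indicator_of_mem (show (t, x) ∈ univ ×ˢ Q k from ⟨mem_univ _, hx⟩)]
  · rw [indicator_of_notMem hx,
      indicator_of_notMem (show (t, x) ∉ univ ×ˢ Q k from fun h => hx h.2)]
    rfl

/-- The glued weak-form integrand is the sum of the integrands of the pieces. [folklore] -/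
theorem inner_sum_add_sum_sum_apply_mul (a : ι → EuclideanSpace ℝ d) (θ : EuclideanSpace ℝ d)
    (A : ι → Matrix d d ℝ) (D : d → d → ℝ) :
    ⟪∑ k, a k, θ⟫_ℝ + ∑ i, ∑ j, (∑ k, A k) i j * D i j =
      ∑ k, (⟪a k, θ⟫_ℝ + ∑ i, ∑ j, A k i j * D i j) := by
  rw [sum_inner, Finset.sum_add_distrib]
  congr 1
  simp_rw [Matrix.sum_apply, Finset.sum_mul]
  calc ∑ i, ∑ j, ∑ k, A k i j * D i j = ∑ i, ∑ k, ∑ j, A k i j * D i j :=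
        Finset.sum_congr rfl fun i _ => Finset.sum_comm
    _ = ∑ k, ∑ i, ∑ j, A k i j * D i j := Finset.sum_comm

end Algebra

/-! ### Gluing finitely many spatially localized perturbations -/

section Pieces

/-- **Székelyhidi's localized convex-integration theorem from its spatially localized
instances.** Let `Q₁, …, Q_m ⊆ T²` be pairwise disjoint open sets covering `T²` up to a null
set. If the conclusion of `Szekelyhidi2011_thm13` is available for every admissible datum
whose region `U` is contained in `(0,T) × Q_k` (for each `k`), then it holds for every region
`U ⊆ (0,T) × T²`: apply the instances to the pieces `U_k = U ∩ (ℝ × Q_k)` and glue,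
`ṽ = ∑ₖ ṽₖ`, `ũ = ∑ₖ 𝟙_{Q_k} ũₖ`. The stresses are truncated to their pieces so that the
constitutive identity (6) survives *on every time slice* (the `ũₖ` are only known to vanish off
`U_k` a.e. in space–time); slice by slice, a.e. `x` lies in exactly one `Q_k`, where the glued
fields coincide with `(ṽₖ, ũₖ)`, and the weak identities add up (Fubini on `(0,T) × T²`, all
fields being bounded). This is the covering step "inside the region `U`" of the printed proof
(Székelyhidi 2011, proof of Thm. 1.3; De Lellis–Székelyhidi 2010, §4.5, Step 1), isolated as the
reduction of the torus statement to regions lying over a single chart.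
[cite: Szekelyhidi2011, Thm. 1.3 and its proof] [cite: DeLellisSzekelyhidi2010, Prop. 2, §4.5] -/
theorem Szekelyhidi2011_thm13_of_pieces {ι : Type*} [Fintype ι] (Q : ι → Set (UnitAddTorus (Fin 2)))
    (hQo : ∀ k, IsOpen (Q k)) (hQd : Pairwise fun k l => Disjoint (Q k) (Q l))
    (hQae : ∀ᵐ x : UnitAddTorus (Fin 2) ∂volume, ∃ k, x ∈ Q k)
    (hloc : ∀ (k : ι) (T : ℝ) (e : ℝ → UnitAddTorus (Fin 2) → ℝ)
      (v : ℝ → UnitAddTorus (Fin 2) → EuclideanSpace ℝ (Fin 2))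
      (u : ℝ → UnitAddTorus (Fin 2) → Matrix (Fin 2) (Fin 2) ℝ)
      (q : ℝ → UnitAddTorus (Fin 2) → ℝ) (U : Set (ℝ × UnitAddTorus (Fin 2))),
      IsEulerSubsolutionOn T e v u q →
      IsOpen U → U ⊆ Ioo 0 T ×ˢ Q k →
      ContinuousOn (uncurry e) U → ContinuousOn (uncurry v) U →
      (∀ i j, ContinuousOn (fun p : ℝ × UnitAddTorus (Fin 2) => u p.1 p.2 i j) U) →
      ContinuousOn (uncurry q) U →
      (∃ M : ℝ, ∀ p ∈ U, e p.1 p.2 ≤ M) →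
      (∀ p ∈ U, ((e p.1 p.2) • (1 : Matrix (Fin 2) (Fin 2) ℝ) -
        (Matrix.vecMulVec (v p.1 p.2) (v p.1 p.2) - u p.1 p.2)).PosDef) →
      ∃ (w : ℝ → UnitAddTorus (Fin 2) → EuclideanSpace ℝ (Fin 2))
        (z : ℝ → UnitAddTorus (Fin 2) → Matrix (Fin 2) (Fin 2) ℝ),
        AEStronglyMeasurable (uncurry w) volume ∧
        (∀ i j, AEStronglyMeasurable (fun p : ℝ × UnitAddTorus (Fin 2) => z p.1 p.2 i j) volume) ∧
        (∃ C : ℝ, (∀ t, ∀ᵐ x ∂volume, ‖w t x‖ ≤ C) ∧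
          ∀ i j, ∀ᵐ p : ℝ × UnitAddTorus (Fin 2) ∂volume, |z p.1 p.2 i j| ≤ C) ∧
        (∀ t x, (z t x).IsSymm ∧ (z t x).trace = 0) ∧
        (∀ t, MemLp (w t) 2 volume) ∧
        (∀ g : UnitAddTorus (Fin 2) → EuclideanSpace ℝ (Fin 2), MemLp g 2 volume →
          Continuous fun t => ∫ x, ⟪w t x, g x⟫_ℝ) ∧
        (∀ φ : ℝ → UnitAddTorus (Fin 2) → EuclideanSpace ℝ (Fin 2), ContDiff ℝ ∞ (stLift φ) →
          ∫ t in Ioo 0 T, ∫ x, (⟪w t x, timeDeriv φ t x⟫_ℝ +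
            ∑ i, ∑ j, z t x i j *
              FunctionSpaces.Torus.fderiv (φ t) x (EuclideanSpace.single j 1) i) = 0) ∧
        (∀ t, IsWeaklyDivFree (w t)) ∧
        (∀ᵐ p : ℝ × UnitAddTorus (Fin 2) ∂volume, p ∉ U → w p.1 p.2 = 0 ∧ z p.1 p.2 = 0) ∧
        (∀ t, ∀ᵐ x ∂volume, (t, x) ∉ U → w t x = 0) ∧
        (∀ᵐ p : ℝ × UnitAddTorus (Fin 2) ∂volume, p ∈ U →
          Matrix.vecMulVec (v p.1 p.2 + w p.1 p.2) (v p.1 p.2 + w p.1 p.2) -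
            (u p.1 p.2 + z p.1 p.2) = (e p.1 p.2) • (1 : Matrix (Fin 2) (Fin 2) ℝ)) ∧
        (∀ t, ∀ᵐ x ∂volume, (t, x) ∈ U →
          Matrix.vecMulVec (v t x + w t x) (v t x + w t x) - (u t x + z t x) =
            (e t x) • (1 : Matrix (Fin 2) (Fin 2) ℝ))) :
    Szekelyhidi2011_thm13 := by
  intro T e v u q U hsub hUo hUT hec hvc huc hqc hM hpos
  -- the pieces `U_k = U ∩ (ℝ × Q_k)`
  set Up : ι → Set (ℝ × UnitAddTorus (Fin 2)) := fun k => U ∩ univ ×ˢ Q k with hUp_def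
  have hUpU : ∀ k, Up k ⊆ U := fun k => inter_subset_left
  have hmemUp : ∀ {k} {p : ℝ × UnitAddTorus (Fin 2)}, p ∈ Up k ↔ p ∈ U ∧ p.2 ∈ Q k := by
    intro k p
    simp [hUp_def, mem_prod]
  have hex : ∀ k, ∃ (w : ℝ → UnitAddTorus (Fin 2) → EuclideanSpace ℝ (Fin 2))
      (z : ℝ → UnitAddTorus (Fin 2) → Matrix (Fin 2) (Fin 2) ℝ),
      AEStronglyMeasurable (uncurry w) volume ∧
      (∀ i j, AEStronglyMeasurable (fun p : ℝ × UnitAddTorus (Fin 2) => z p.1 p.2 i j) volume) ∧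
      (∃ C : ℝ, (∀ t, ∀ᵐ x ∂volume, ‖w t x‖ ≤ C) ∧
        ∀ i j, ∀ᵐ p : ℝ × UnitAddTorus (Fin 2) ∂volume, |z p.1 p.2 i j| ≤ C) ∧
      (∀ t x, (z t x).IsSymm ∧ (z t x).trace = 0) ∧
      (∀ t, MemLp (w t) 2 volume) ∧
      (∀ g : UnitAddTorus (Fin 2) → EuclideanSpace ℝ (Fin 2), MemLp g 2 volume →
        Continuous fun t => ∫ x, ⟪w t x, g x⟫_ℝ) ∧
      (∀ φ : ℝ → UnitAddTorus (Fin 2) → EuclideanSpace ℝ (Fin 2), ContDiff ℝ ∞ (stLift φ) →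
        ∫ t in Ioo 0 T, ∫ x, (⟪w t x, timeDeriv φ t x⟫_ℝ +
          ∑ i, ∑ j, z t x i j *
            FunctionSpaces.Torus.fderiv (φ t) x (EuclideanSpace.single j 1) i) = 0) ∧
      (∀ t, IsWeaklyDivFree (w t)) ∧
      (∀ᵐ p : ℝ × UnitAddTorus (Fin 2) ∂volume, p ∉ Up k → w p.1 p.2 = 0 ∧ z p.1 p.2 = 0) ∧
      (∀ t, ∀ᵐ x ∂volume, (t, x) ∉ Up k → w t x = 0) ∧
      (∀ᵐ p : ℝ × UnitAddTorus (Fin 2) ∂volume, p ∈ Up k →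
        Matrix.vecMulVec (v p.1 p.2 + w p.1 p.2) (v p.1 p.2 + w p.1 p.2) -
          (u p.1 p.2 + z p.1 p.2) = (e p.1 p.2) • (1 : Matrix (Fin 2) (Fin 2) ℝ)) ∧
      (∀ t, ∀ᵐ x ∂volume, (t, x) ∈ Up k →
        Matrix.vecMulVec (v t x + w t x) (v t x + w t x) - (u t x + z t x) =
          (e t x) • (1 : Matrix (Fin 2) (Fin 2) ℝ)) := by
    intro k
    have hUo' : IsOpen (Up k) := hUo.inter (isOpen_univ.prod (hQo k))
    have hUT' : Up k ⊆ Ioo 0 T ×ˢ Q k := fun p hp => ⟨(hUT hp.1).1, hp.2.2⟩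
    exact hloc k T e v u q (Up k) hsub hUo' hUT' (hec.mono (hUpU k)) (hvc.mono (hUpU k))
      (fun i j => (huc i j).mono (hUpU k)) (hqc.mono (hUpU k))
      (hM.imp fun M hM' => fun p hp => hM' p (hUpU k hp)) (fun p hp => hpos p (hUpU k hp))
  choose w z hwm hzm hbd hsymm hw2 hwc hpde hdiv hoff hoffs h6 h6s using hex
  choose C hwC hzC using hbd
  -- disjointness: a point of `Q_k` lies in no other `Q_l`
  have hnot : ∀ {k l : ι} {x : UnitAddTorus (Fin 2)}, x ∈ Q k → l ≠ k → x ∉ Q l :=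
    fun {k l x} hx hlk hxl => Set.disjoint_left.1 (hQd hlk) hxl hx
  -- the glued fields
  refine ⟨fun t x => ∑ k, w k t x, fun t x => ∑ k, (Q k).indicator (z k t) x,
    ?_, ?_, ?_, ?_, ?_, ?_, ?_, ?_, ?_, ?_, ?_, ?_⟩
  · -- joint measurability of `ṽ`
    have h : (uncurry fun t x => ∑ k, w k t x) =
        fun p : ℝ × UnitAddTorus (Fin 2) => ∑ k, uncurry (w k) p := by
      funext p; rfl
    rw [h]
    exact Finset.aestronglyMeasurable_fun_sum _ fun k _ => hwm k
  · -- joint measurability of the entries of `ũ`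
    intro i j
    have h : (fun p : ℝ × UnitAddTorus (Fin 2) => (∑ k, (Q k).indicator (z k p.1) p.2) i j) =
        fun p => ∑ k, (univ ×ˢ Q k).indicator
          (fun p : ℝ × UnitAddTorus (Fin 2) => z k p.1 p.2 i j) p := by
      funext p
      exact sum_indicator_apply_apply Q z p.1 p.2 i j
    rw [h]
    exact Finset.aestronglyMeasurable_fun_sum _ fun k _ =>
      (hzm k i j).indicator (MeasurableSet.univ.prod (hQo k).measurableSet)
  · -- common `L^∞` bound
    refine ⟨∑ k, C k, fun t => ?_, fun i j => ?_⟩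
    · filter_upwards [eventually_all.2 fun k => hwC k t] with x hx
      exact (norm_sum_le _ _).trans (Finset.sum_le_sum fun k _ => hx k)
    · filter_upwards [eventually_all.2 fun k => hzC k i j] with p hp
      rw [sum_indicator_apply_apply Q z p.1 p.2 i j]
      refine (Finset.abs_sum_le_sum_abs _ _).trans (Finset.sum_le_sum fun k _ => ?_)
      refine le_trans ?_ (hp k)
      rw [← Real.norm_eq_abs, ← Real.norm_eq_abs]
      exact norm_indicator_le_norm_self _ _
  · -- symmetric and trace-free
    intro t x
    beta_reduce
    constructor
    · refine Matrix.IsSymm.ext fun i j => ?_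
      rw [Matrix.sum_apply, Matrix.sum_apply]
      refine Finset.sum_congr rfl fun k _ => ?_
      by_cases hx : x ∈ Q k
      · rw [indicator_of_mem hx]
        exact (hsymm k t x).1.apply i j
      · rw [indicator_of_notMem hx]
        rfl
    · rw [Matrix.trace_sum]
      refine Finset.sum_eq_zero fun k _ => ?_
      by_cases hx : x ∈ Q k
      · rw [indicator_of_mem hx]
        exact (hsymm k t x).2
      · rw [indicator_of_notMem hx, Matrix.trace_zero]
  · -- `L²` slices
    intro t
    exact memLp_finsetSum _ fun k _ => hw2 k t
  · -- weak continuity into `L²`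
    intro g hg
    have h : (fun t => ∫ x, ⟪∑ k, w k t x, g x⟫_ℝ) = fun t => ∑ k, ∫ x, ⟪w k t x, g x⟫_ℝ := by
      funext t
      rw [← integral_finsetSum _ fun k _ => integrable_inner_L2 (hw2 k t) hg]
      refine integral_congr_ae (ae_of_all _ fun x => ?_)
      exact sum_inner _ _ _
    rw [h]
    exact continuous_finsetSum _ fun k _ => hwc k g hg
  · -- the linear system
    intro φ hφ
    beta_reduce
    -- derivatives of the test field: continuity and bounds on `[0, T]`
    have hθc : Continuous (uncurry (timeDeriv φ)) :=
      continuous_uncurry_timeDeriv_of_contDiff_stLift hφ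
    obtain ⟨Cθ, hCθ⟩ :=
      exists_bound_timeDeriv_of_contDiff_stLift hφ (isCompact_Icc (a := (0 : ℝ)) (b := T))
    have hDc : ∀ j i, Continuous (uncurry fun t x =>
        FunctionSpaces.Torus.fderiv (φ t) x (EuclideanSpace.single j 1) i) :=
      fun j i => continuous_uncurry_fderiv_apply_of_contDiff_stLift hφ _ i
    obtain ⟨M, -, hM⟩ :=
      exists_bound_fderiv_apply_of_contDiff_stLift hφ (isCompact_Icc (a := (0 : ℝ)) (b := T))
    -- the product measure on `(0,T) × T²`
    set μ : Measure (ℝ × UnitAddTorus (Fin 2)) :=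
      (volume.restrict (Ioo (0 : ℝ) T)).prod volume with hμ_def
    have hμ : μ = volume.restrict (Ioo (0 : ℝ) T ×ˢ univ) := restrict_prod_volume_eq_restrict T
    have hmem : ∀ᵐ p ∂μ, p.1 ∈ Ioo (0 : ℝ) T := by
      rw [hμ]
      filter_upwards [ae_restrict_mem (measurableSet_Ioo.prod MeasurableSet.univ)] with p hp
        using hp.1
    have hae_of : ∀ {P : ℝ × UnitAddTorus (Fin 2) → Prop}, (∀ᵐ p ∂volume, P p) → ∀ᵐ p ∂μ, P p :=
        fun h => by
      rw [hμ]; exact ae_restrict_of_ae h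
    -- the integrands of the pieces, with and without truncation of the stresses
    set D : ℝ × UnitAddTorus (Fin 2) → Fin 2 → Fin 2 → ℝ := fun p i j =>
      FunctionSpaces.Torus.fderiv (φ p.1) p.2 (EuclideanSpace.single j 1) i with hD_def
    set Fk : ι → ℝ × UnitAddTorus (Fin 2) → ℝ := fun k p =>
      ⟪w k p.1 p.2, timeDeriv φ p.1 p.2⟫_ℝ + ∑ i, ∑ j, z k p.1 p.2 i j * D p i j with hFk_def
    set Gk : ι → ℝ × UnitAddTorus (Fin 2) → ℝ := fun k p =>
      ⟪w k p.1 p.2, timeDeriv φ p.1 p.2⟫_ℝ +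
        ∑ i, ∑ j, (Q k).indicator (z k p.1) p.2 i j * D p i j with hGk_def
    -- `Gk = Fk` a.e.: the stresses vanish off their pieces a.e. in space–time
    have hGF : ∀ k, Gk k =ᵐ[μ] Fk k := by
      intro k
      filter_upwards [hae_of (hoff k)] with p hp
      simp only [hGk_def, hFk_def]
      congr 1
      refine Finset.sum_congr rfl fun i _ => Finset.sum_congr rfl fun j _ => ?_
      by_cases hx : p.2 ∈ Q k
      · rw [indicator_of_mem hx]
      · rw [indicator_of_notMem hx, (hp fun h => hx (hmemUp.1 h).2).2]
    -- measurability
    have hwμ : ∀ k, AEStronglyMeasurable (uncurry (w k)) μ := fun k => by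
      rw [hμ]; exact (hwm k).restrict
    have hzμ : ∀ k i j,
        AEStronglyMeasurable (fun p : ℝ × UnitAddTorus (Fin 2) => z k p.1 p.2 i j) μ :=
      fun k i j => by rw [hμ]; exact (hzm k i j).restrict
    have hFm : ∀ k, AEStronglyMeasurable (Fk k) μ := by
      intro k
      refine (AEStronglyMeasurable.inner (hwμ k) hθc.aestronglyMeasurable).add ?_
      refine Finset.aestronglyMeasurable_fun_sum _ fun i _ =>
        Finset.aestronglyMeasurable_fun_sum _ fun j _ => ?_
      exact (hzμ k i j).mul (hDc j i).aestronglyMeasurable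
    -- bounds
    have hwb : ∀ k, ∀ᵐ p ∂μ, ‖w k p.1 p.2‖ ≤ C k := fun k =>
      hae_of (ae_prod_norm_le_of_slices (hwm k) (hwC k))
    have hFb : ∀ k, ∀ᵐ p ∂μ, ‖Fk k p‖ ≤ C k * |Cθ| + 4 * (C k * M) := by
      intro k
      filter_upwards [hmem, hwb k, hae_of (hzC k 0 0), hae_of (hzC k 0 1), hae_of (hzC k 1 0),
        hae_of (hzC k 1 1)] with p hp hwp h00 h01 h10 h11
      have hzall : ∀ i j, |z k p.1 p.2 i j| ≤ C k := by
        intro i j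
        fin_cases i <;> fin_cases j
        · exact h00
        · exact h01
        · exact h10
        · exact h11
      have hIcc : p.1 ∈ Icc (0 : ℝ) T := Ioo_subset_Icc_self hp
      have hC0 : 0 ≤ C k := (norm_nonneg _).trans hwp
      have h1 : ‖⟪w k p.1 p.2, timeDeriv φ p.1 p.2⟫_ℝ‖ ≤ C k * |Cθ| :=
        (norm_inner_le_norm _ _).trans (mul_le_mul hwp
          ((hCθ p.1 hIcc p.2).trans (le_abs_self _)) (norm_nonneg _) hC0)
      have hterm : ∀ i j, |z k p.1 p.2 i j * D p i j| ≤ C k * M := by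
        intro i j
        rw [abs_mul]
        exact mul_le_mul (hzall i j) (hM p.1 hIcc p.2 j i) (abs_nonneg _) hC0
      have h2 : |∑ i, ∑ j, z k p.1 p.2 i j * D p i j| ≤ 4 * (C k * M) := by
        calc |∑ i, ∑ j, z k p.1 p.2 i j * D p i j|
            ≤ ∑ i, |∑ j, z k p.1 p.2 i j * D p i j| := Finset.abs_sum_le_sum_abs _ _
          _ ≤ ∑ i, ∑ j, |z k p.1 p.2 i j * D p i j| :=
              Finset.sum_le_sum fun i _ => Finset.abs_sum_le_sum_abs _ _
          _ ≤ ∑ _i : Fin 2, ∑ _j : Fin 2, C k * M :=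
              Finset.sum_le_sum fun i _ => Finset.sum_le_sum fun j _ => hterm i j
          _ = 4 * (C k * M) := by
              simp only [Finset.sum_const, Finset.card_univ, Fintype.card_fin]; ring
      calc ‖Fk k p‖
          = |⟪w k p.1 p.2, timeDeriv φ p.1 p.2⟫_ℝ + ∑ i, ∑ j, z k p.1 p.2 i j * D p i j| := by
            simp only [hFk_def, Real.norm_eq_abs]
        _ ≤ |⟪w k p.1 p.2, timeDeriv φ p.1 p.2⟫_ℝ| + |∑ i, ∑ j, z k p.1 p.2 i j * D p i j| :=
            abs_add_le _ _
        _ ≤ C k * |Cθ| + 4 * (C k * M) := add_le_add (by rw [← Real.norm_eq_abs]; exact h1) h2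
    have hFi : ∀ k, Integrable (Fk k) μ := fun k => Integrable.of_bound (hFm k) _ (hFb k)
    have hGi : ∀ k, Integrable (Gk k) μ := fun k => (hFi k).congr (hGF k).symm
    -- assemble: `∫∫ Σₖ Gₖ = Σₖ ∫∫ Gₖ = Σₖ ∫∫ Fₖ = 0`
    calc ∫ t in Ioo 0 T, ∫ x, (⟪∑ k, w k t x, timeDeriv φ t x⟫_ℝ +
            ∑ i, ∑ j, (∑ k, (Q k).indicator (z k t) x) i j *
              FunctionSpaces.Torus.fderiv (φ t) x (EuclideanSpace.single j 1) i)
        = ∫ t in Ioo 0 T, ∫ x, ∑ k, Gk k (t, x) := by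
          refine integral_congr_ae (ae_of_all _ fun t =>
            integral_congr_ae (ae_of_all _ fun x => ?_))
          exact inner_sum_add_sum_sum_apply_mul (fun k => w k t x) (timeDeriv φ t x)
            (fun k => (Q k).indicator (z k t) x) (fun i j => D (t, x) i j)
      _ = ∫ p, ∑ k, Gk k p ∂μ := (integral_prod _ (integrable_finsetSum _ fun k _ => hGi k)).symm
      _ = ∑ k, ∫ p, Gk k p ∂μ := integral_finsetSum _ fun k _ => hGi k
      _ = ∑ k, ∫ p, Fk k p ∂μ := Finset.sum_congr rfl fun k _ => integral_congr_ae (hGF k)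
      _ = ∑ k, ∫ t in Ioo 0 T, ∫ x, Fk k (t, x) :=
          Finset.sum_congr rfl fun k _ => integral_prod _ (hFi k)
      _ = ∑ _k : ι, (0 : ℝ) := Finset.sum_congr rfl fun k _ => hpde k φ hφ
      _ = 0 := Finset.sum_const_zero
  · -- weak incompressibility on every slice
    intro t θ hθ
    have hI : ∀ k, Integrable (fun x => ⟪w k t x, FunctionSpaces.Torus.gradient θ x⟫_ℝ) volume :=
      fun k => integrable_inner_L2 (hw2 k t) (hθ.gradient.memLp 2)
    calc ∫ x, ⟪∑ k, w k t x, FunctionSpaces.Torus.gradient θ x⟫_ℝ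
        = ∫ x, ∑ k, ⟪w k t x, FunctionSpaces.Torus.gradient θ x⟫_ℝ :=
          integral_congr_ae (ae_of_all _ fun x => sum_inner _ _ _)
      _ = ∑ k, ∫ x, ⟪w k t x, FunctionSpaces.Torus.gradient θ x⟫_ℝ :=
          integral_finsetSum _ fun k _ => hI k
      _ = 0 := Finset.sum_eq_zero fun k _ => hdiv k t θ hθ
  · -- vanishing off `U`, a.e. in space–time
    filter_upwards [eventually_all.2 hoff] with p hp hpU
    have hp' : ∀ k, w k p.1 p.2 = 0 ∧ z k p.1 p.2 = 0 := fun k => hp k fun h => hpU (hUpU k h)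
    refine ⟨Finset.sum_eq_zero fun k _ => (hp' k).1, Finset.sum_eq_zero fun k _ => ?_⟩
    by_cases hx : p.2 ∈ Q k
    · rw [indicator_of_mem hx]
      exact (hp' k).2
    · exact indicator_of_notMem hx _
  · -- vanishing of `ṽ` off `U` on every slice
    intro t
    filter_upwards [eventually_all.2 fun k => hoffs k t] with x hx hxU
    exact Finset.sum_eq_zero fun k _ => hx k fun h => hxU (hUpU k h)
  · -- (6) a.e. in `U`
    have hQae' : ∀ᵐ p : ℝ × UnitAddTorus (Fin 2) ∂volume, ∃ k, p.2 ∈ Q k := by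
      rw [Measure.volume_eq_prod]
      exact Measure.quasiMeasurePreserving_snd.ae hQae
    filter_upwards [hQae', eventually_all.2 hoff, eventually_all.2 h6] with p hpQ hoffp h6p hpU
    obtain ⟨k, hk⟩ := hpQ
    have hw0 : ∀ l, l ≠ k → w l p.1 p.2 = 0 := fun l hlk =>
      (hoffp l fun h => hnot hk hlk (hmemUp.1 h).2).1
    have hW : ∑ l, w l p.1 p.2 = w k p.1 p.2 :=
      Finset.sum_eq_single k (fun l _ hlk => hw0 l hlk) fun h => absurd (Finset.mem_univ k) h
    have hZ : ∑ l, (Q l).indicator (z l p.1) p.2 = z k p.1 p.2 := by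
      rw [Finset.sum_eq_single k (fun l _ hlk => indicator_of_notMem (hnot hk hlk) _)
        fun h => absurd (Finset.mem_univ k) h, indicator_of_mem hk]
    rw [hW, hZ]
    exact h6p k (hmemUp.2 ⟨hpU, hk⟩)
  · -- (6) on every slice of `U`
    intro t
    filter_upwards [hQae, eventually_all.2 fun k => hoffs k t, eventually_all.2 fun k => h6s k t]
      with x hxQ hoffx h6x hxU
    obtain ⟨k, hk⟩ := hxQ
    have hw0 : ∀ l, l ≠ k → w l t x = 0 := fun l hlk =>
      hoffx l fun h => hnot hk hlk (hmemUp.1 h).2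
    have hW : ∑ l, w l t x = w k t x :=
      Finset.sum_eq_single k (fun l _ hlk => hw0 l hlk) fun h => absurd (Finset.mem_univ k) h
    have hZ : ∑ l, (Q l).indicator (z l t) x = z k t x := by
      rw [Finset.sum_eq_single k (fun l _ hlk => indicator_of_notMem (hnot hk hlk) _)
        fun h => absurd (Finset.mem_univ k) h, indicator_of_mem hk]
    rw [hW, hZ]
    exact h6x k (hmemUp.2 ⟨hxU, hk⟩)

end Pieces

end Torus

end Literature.Analysis.FluidPDE
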